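import Literature.MathematicalPhysics.QuantumFieldTheory.Balaban1983to89.Beta.AveragingHessianKernelsRooted

/-!
# `BalabanUV.Beta.GAN24.ContactFaceJump` — binder row G-an2-4 / (CONV-C), CT-ROUTE, the row owner's `gen20/BORNSEC-PLAN-v1.md` §A (Λ-C)(C3) «[leaf-01∕02; S]»:
# **THE FOUR-SITE GAUGE WEIGHT OF THE Λ CONTACT KERNEL IS A FACE JUMP FOR BLOCK-CONSTANT GAUGE FUNCTIONS, AND FOR A STAIRCASE ONLY THE JUMPS OF THE SCALES
# WHOSE FACE THE COARSE BOND CROSSES (PLUS THE FINEST PIECE) SURVIVE** — plan §0 (c2)(α)(β): NOT `sup|λ| ~ N·αE`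

NOT IN PRINT; OUR BOOKKEEPING (G-an2-4 formalisation swarm → CRUX TEAM (2), leaf prover `b2b-balaban-gan24-formalise-leaf-01`, gen 60; INTENT «FACE-JUMP» journal
`CLAIMS.log` l.33586; names PROVISIONAL — the owner may rename ∕ re-cut).  [folklore] lattice bookkeeping over an1's node 5ρ ∕ 7aρ (`gammaCAt`, `linCountAt`, `linKerAt`,
`Hull`, `mem_segUp ∕ mem_segDown`, `corner_succ_add`, `blk_block`) BY NAME;
0 `def`, 0 cited facts, 0 `def … : Prop`, 0 sorry.  HONEST FRAMING (cell contract, verbatim): «discharging `BetaPertH` makes Bałaban's UV stability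
UNCONDITIONAL — a real constructive-QFT result; it is NOT the continuum limit and NOT the Clay problem.»  HONEST DEPENDENCY (verbatim): «continuum YM on T⁴ ⇐ BetaPertH ∧
nine spine estimates (0/9 proved); BetaPertH ⇐ (D1) ∧ (D4) ∧ CAP+tail; G-an2-4 gates asym, D1 and NE2/3/4.»

## Why (plan v1 §0 (c2))
The Λ one-gauge contact cells of leaf-02's `Push3LambdaKernelCells.contact_lambda_eq_cells` ∕ leaf-01's `BornLambdaContactCells.contact_bornLam_*_eq_cells_three` carry the
kernel `KΛ(ψ; κ,u; b,z) = −Σ_μ Σ'_y c μ y κ u·(w₄(ψ; b,z; μ,y)·q¹,ρ_{(μ,y)}(b,z)∕2)` with the FOUR-SITE WEIGHT `w₄(ψ; b,z; μ,y) = ψ z + ψ(z+e_b) − ψ(L·y+ρ) − ψ(L·y+ρ+L·e_μ)`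
(the infinitesimal covariance law of the rooted one-step average).  The route's gauge function is a STAIRCASE `ψ = Σ_{s≤n} G s ∘ blk (Lc^s)` (`ContactGaugeStaircase`);
bounding `w₄` by `4·sup|ψ|` (leaf-02's `abs_hessWeight_le`) costs `N·αE` and kills the born rows (owner's RULING R-gan24p1-g20-1).  Here: every piece with `s ≥ 1` is
constant on the `Lc`-blocks, and on the support of `q¹,ρ_{(μ,y)}` a block-constant `ψ = h ∘ blk L` has `|w₄| ≤ |h(y+e_μ) − h y|` — the jump across the ONE face between
the blocks `y` and `y+e_μ`; for the piece of scale `s ≥ 1` that jump vanishes unless the coarse bond `(μ,y)` crosses a face of scale `s−1` (`Lc^{s−1} ∣ y_μ + 1`).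

## What (generic `d`; box root `ρ = toSite rr`, `rr ∈ box (d+1) L`)
* §1 THE TWO-BLOCK SUPPORT OF THE ROOTED ONE-STEP KERNEL (an1's `Near L y` sharpened, and stated for the FAR endpoint too): both endpoints of every bond of the rooted
  contour `Γ^ρ_{(μ,y),x}` have block label `y` or `y + e_μ` (`twoBlock_gammaCAt`); hence **`linCountAt_eq_zero_of_not_twoBlock`** ∕ `linKerAt_eq_zero_of_not_twoBlock`.
* §2 BLOCK-CONSTANT GAUGE FUNCTIONS `ψ = h ∘ blk L`, EVERY bond `(b,z)`: **`abs_weight_mul_linKerAt_le`** ∕ `abs_weight_mul_linCountAt_le`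
  (`|w₄(ψ; b,z; μ,y)·q¹,ρ_{(μ,y)}(b,z)| ≤ |h(y+e_μ) − h y|·|q¹,ρ_{(μ,y)}(b,z)|`), **`abs_dz_mul_linCountAt_le`** (the gradient on the support is at most the one jump), and the EXACT
  **`weight_mul_dz_mul_linCountAt_eq_zero`** — on the support the face jumps of two block-constant functions NEVER MULTIPLY (owner's plan v1.1 §0′: the ΔΔ cell has no `Δ_a·Δ_b`).
PART 2 (`ContactFaceJumpStaircase`): staircases — only the face jumps of the scales whose face the coarse bond crosses, plus the finest piece, survive; the route's instance.
Discharges NO slot letter; NO estimate of Bałaban's; 0 wall binders; NEVER «G-an2-4 closed»; NOT D1, NOT BetaPertH, NOT continuum, NOT Clay.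
-/

noncomputable section

open Finset
open scoped BigOperators
open Literature.MathematicalPhysics.QuantumFieldTheory
open Literature.MathematicalPhysics.QuantumFieldTheory.Balaban1983to89
open Literature.MathematicalPhysics.QuantumFieldTheory.Balaban1983to89.Beta
open AffineAveraging (Form0 Form1 Site box toSite unitVec unitVec_apply)
open AveragingContours (blk blk_block seg segUp segDown rev axial axialAux corner corner_succ_add)
open AveragingContoursRooted (gammaCAt linAvgAt)
open AveragingHessianKernels (Bond δ1 δ1_apply Hull mem_segUp mem_segDown corner_apply_or)
open AveragingHessianKernelsRooted (linCountAt linKerAt)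

namespace Summit.QuantumFields.BalabanUV.Beta.GAN24.ContactFaceJump

variable {d : ℕ}

/-! ## §1 Both endpoints of every bond of the rooted contour lie in the two blocks `y`, `y + e_μ` -/

section Support

variable {R : Type*} [AddCommGroup R]

/-- [folklore] Both endpoints of every bond of a signed straight segment lie in the coordinate hull of its endpoints (an1's `lettersIn_seg`, far endpoint added). -/
theorem bonds_seg (A : Form1 (d + 1) R) (z : Site (d + 1)) (κ : Fin (d + 1)) (n : ℤ) :
    ∀ a ∈ seg A z κ n, ∃ (κ' : Fin (d + 1)) (x' : Site (d + 1)),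
      Hull z (z + n • unitVec κ) x' ∧ Hull z (z + n • unitVec κ) (x' + unitVec κ') ∧ (a = A κ' x' ∨ a = -A κ' x') := by
  intro a ha
  unfold AveragingContours.seg at ha
  split_ifs at ha with hn
  · obtain ⟨s, hs', rfl⟩ := mem_segUp ha
    refine ⟨κ, _, fun i => ?_, fun i => ?_, Or.inl rfl⟩
    · simp only [Pi.add_apply, Pi.smul_apply, unitVec_apply, smul_eq_mul]
      refine ⟨min_le_iff.2 ?_, le_max_iff.2 ?_⟩ <;> split_ifs <;> omega
    · simp only [Pi.add_apply, Pi.smul_apply, unitVec_apply, smul_eq_mul]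
      refine ⟨min_le_iff.2 ?_, le_max_iff.2 ?_⟩ <;> split_ifs <;> omega
  · obtain ⟨s, hs', rfl⟩ := mem_segDown ha
    refine ⟨κ, _, fun i => ?_, fun i => ?_, Or.inr rfl⟩
    · simp only [Pi.add_apply, Pi.sub_apply, Pi.smul_apply, unitVec_apply, smul_eq_mul]
      refine ⟨min_le_iff.2 ?_, le_max_iff.2 ?_⟩ <;> split_ifs <;> omega
    · simp only [Pi.add_apply, Pi.sub_apply, Pi.smul_apply, unitVec_apply, smul_eq_mul]
      refine ⟨min_le_iff.2 ?_, le_max_iff.2 ?_⟩ <;> split_ifs <;> omega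

/-- [folklore] The hull of two consecutive corners lies in the hull of the endpoints (an1's `lettersIn_axialAux`, pointwise). -/
theorem hull_of_hull_corner (y x : Site (d + 1)) (m : ℕ) {x' : Site (d + 1)} (hx' : Hull (corner y x (m + 1)) (corner y x m) x') : Hull y x x' := by
  intro i
  have h1 := hx' i
  rcases corner_apply_or y x (m + 1) i with e1 | e1 <;> rcases corner_apply_or y x m i with e2 | e2 <;>
    · rw [e1, e2] at h1
      refine ⟨min_le_iff.2 ?_, le_max_iff.2 ?_⟩ <;>
        rcases h1 with ⟨h1a, h1b⟩ <;> rw [min_le_iff] at h1a <;> rw [le_max_iff] at h1b <;> omega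

/-- [folklore] Both endpoints of every bond of the axial contour pieces lie in the hull of the endpoints. -/
theorem bonds_axialAux (A : Form1 (d + 1) R) (y x : Site (d + 1)) :
    ∀ m, ∀ a ∈ axialAux A y x m, ∃ (κ' : Fin (d + 1)) (x' : Site (d + 1)),
      Hull y x x' ∧ Hull y x (x' + unitVec κ') ∧ (a = A κ' x' ∨ a = -A κ' x')
  | 0 => fun a ha => by simp [AveragingContours.axialAux] at ha
  | m + 1 => by
    intro a ha
    simp only [AveragingContours.axialAux, List.mem_append] at ha
    rcases ha with ha | ha
    · split_ifs at ha with h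
      · have hs := bonds_seg A (corner y x (m + 1)) ⟨m, h⟩ (x ⟨m, h⟩ - y ⟨m, h⟩) a ha
        rw [corner_succ_add] at hs
        obtain ⟨κ', x', h1, h2, h3⟩ := hs
        exact ⟨κ', x', hull_of_hull_corner y x m h1, hull_of_hull_corner y x m h2, h3⟩
      · simp at ha
    · exact bonds_axialAux A y x m a ha

/-- [folklore] Both endpoints of every bond of the axial contour `Γ_{y,x}` lie in the hull of `y` and `x`. -/
theorem bonds_axial (A : Form1 (d + 1) R) (y x : Site (d + 1)) :
    ∀ a ∈ axial A y x, ∃ (κ' : Fin (d + 1)) (x' : Site (d + 1)),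
      Hull y x x' ∧ Hull y x (x' + unitVec κ') ∧ (a = A κ' x' ∨ a = -A κ' x') :=
  bonds_axialAux A y x (d + 1)

omit [AddCommGroup R] in
/-- [folklore] A point of the hull of two points of the block `y` lies in the block `y`: its block label is `y`. -/
theorem blk_eq_of_hull_block {L : ℕ} (y : Site (d + 1)) {r b : Fin (d + 1) → ℕ} (hr : r ∈ box (d + 1) L) (hb : b ∈ box (d + 1) L)
    (v : Site (d + 1)) {x' : Site (d + 1)} (hx' : Hull ((L : ℤ) • y + toSite r + v) ((L : ℤ) • y + toSite b + v) x') :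
    blk L (x' - v) = y := by
  have hr' : ∀ i, r i < L := by simpa [AffineAveraging.box, Fintype.mem_piFinset, Finset.mem_range] using hr
  have hb' : ∀ i, b i < L := by simpa [AffineAveraging.box, Fintype.mem_piFinset, Finset.mem_range] using hb
  -- the offset of `x' − v` in the block `y`
  have hoff : ∀ i, 0 ≤ x' i - v i - (L : ℤ) * y i ∧ x' i - v i - (L : ℤ) * y i < L := by
    intro i
    obtain ⟨h1, h2⟩ := hx' i
    have hi := hb' i; have hri := hr' i
    simp only [Pi.add_apply, Pi.smul_apply, smul_eq_mul, toSite] at h1 h2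
    rw [min_le_iff] at h1; rw [le_max_iff] at h2
    constructor <;> omega
  have hc : (fun i => (x' i - v i - (L : ℤ) * y i).toNat) ∈ box (d + 1) L := by
    simp only [AffineAveraging.box, Fintype.mem_piFinset, Finset.mem_range]
    intro i
    have := hoff i
    omega
  have hx : x' - v = (L : ℤ) • y + toSite (fun i => (x' i - v i - (L : ℤ) * y i).toNat) := by
    funext i
    have := hoff i
    simp only [Pi.sub_apply, Pi.add_apply, Pi.smul_apply, smul_eq_mul, toSite]
    rw [Int.toNat_of_nonneg this.1]
    ring
  rw [hx, blk_block y hc]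

/-- NOT IN PRINT; OUR BOOKKEEPING.  **BOTH ENDPOINTS OF EVERY BOND OF THE ROOTED CONTOUR `Γ^ρ_{(μ,y),x}` HAVE BLOCK LABEL `y` OR `y + e_μ`** (box root, `x ∈ B(y)`): the
axial part from the root lies in the block `y`, the straight part climbs from the block `y` into the block `y + e_μ`, the returning axial part lies in the block `y + e_μ`. -/
theorem twoBlock_gammaCAt {L : ℕ} (hL : 1 ≤ L) (A : Form1 (d + 1) R) (μ : Fin (d + 1)) (y : Site (d + 1)) {r b : Fin (d + 1) → ℕ}
    (hr : r ∈ box (d + 1) L) (hb : b ∈ box (d + 1) L) :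
    ∀ a ∈ gammaCAt (toSite r) A L μ y b, ∃ (κ' : Fin (d + 1)) (x' : Site (d + 1)),
      (blk L x' = y ∨ blk L x' = y + unitVec μ) ∧ (blk L (x' + unitVec κ') = y ∨ blk L (x' + unitVec κ') = y + unitVec μ) ∧
      (a = A κ' x' ∨ a = -A κ' x') := by
  have hb' : ∀ i, b i < L := by simpa [AffineAveraging.box, Fintype.mem_piFinset, Finset.mem_range] using hb
  intro a ha
  simp only [AveragingContoursRooted.gammaCAt, List.mem_append] at ha
  rcases ha with (ha | ha) | ha
  · -- the axial part from the root: inside the block `y`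
    obtain ⟨κ', x', h1, h2, h3⟩ := bonds_axial A _ _ a ha
    have e1 := blk_eq_of_hull_block y hr hb 0 (x' := x') (by simpa using h1)
    have e2 := blk_eq_of_hull_block y hr hb 0 (x' := x' + unitVec κ') (by simpa using h2)
    rw [sub_zero] at e1 e2
    exact ⟨κ', x', Or.inl e1, Or.inl e2, h3⟩
  · -- the straight part: `L` bonds in direction `μ` from `L·y + b`
    obtain ⟨s, hs, rfl⟩ := mem_segUp ha
    have hL0 : (L : ℤ) ≠ 0 := by exact_mod_cast (show L ≠ 0 by omega)
    -- block label of `L·y + b + t·e_μ`, `t ≤ L`: coordinatewise Euclidean division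
    have key : ∀ t : ℕ, t ≤ L → blk L ((L : ℤ) • y + toSite b + (t : ℤ) • unitVec μ) = y ∨
        blk L ((L : ℤ) • y + toSite b + (t : ℤ) • unitVec μ) = y + unitVec μ := by
      intro t ht
      by_cases hbt : b μ + t < L
      · left
        funext i
        simp only [blk, Pi.add_apply, Pi.smul_apply, smul_eq_mul, toSite, unitVec_apply]
        have hi := hb' i
        split_ifs with hiμ
        · subst hiμ
          rw [mul_one, add_assoc, add_comm ((L : ℤ) * y i), Int.add_mul_ediv_left _ _ hL0,
            Int.ediv_eq_zero_of_lt (by positivity) (by omega), zero_add]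
        · rw [mul_zero, add_zero, add_comm ((L : ℤ) * y i), Int.add_mul_ediv_left _ _ hL0,
            Int.ediv_eq_zero_of_lt (by positivity) (by exact_mod_cast hi), zero_add]
      · right
        funext i
        simp only [blk, Pi.add_apply, Pi.smul_apply, smul_eq_mul, toSite, unitVec_apply]
        have hi := hb' i
        split_ifs with hiμ
        · subst hiμ
          have e : (L : ℤ) * y i + (b i : ℤ) + (t : ℤ) * 1 = ((b i : ℤ) + t - L) + L * (y i + 1) := by ring
          rw [e, Int.add_mul_ediv_left _ _ hL0, Int.ediv_eq_zero_of_lt (by omega) (by omega), zero_add]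
        · rw [mul_zero, add_zero, add_zero, add_comm ((L : ℤ) * y i), Int.add_mul_ediv_left _ _ hL0,
            Int.ediv_eq_zero_of_lt (by positivity) (by exact_mod_cast hi), zero_add]
    refine ⟨μ, _, key s hs.le, ?_, Or.inl rfl⟩
    have e : (L : ℤ) • y + toSite b + (s : ℤ) • unitVec μ + unitVec μ = (L : ℤ) • y + toSite b + ((s + 1 : ℕ) : ℤ) • unitVec μ := by
      rw [Nat.cast_succ, add_smul, one_smul, add_assoc]
    rw [e]
    exact key (s + 1) (by omega)
  · -- the returning axial part: inside the block `y + e_μ` (letters negated and reversed)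
    unfold AveragingContours.rev at ha
    rw [List.mem_reverse] at ha
    obtain ⟨a', ha', rfl⟩ := List.mem_map.1 ha
    obtain ⟨κ', x', h1, h2, h3⟩ := bonds_axial A _ _ a' ha'
    have ev : ∀ w : Site (d + 1), (L : ℤ) • y + w + (L : ℤ) • unitVec μ = (L : ℤ) • (y + unitVec μ) + w + 0 := by
      intro w; rw [smul_add]; abel
    rw [ev, ev] at h1 h2
    have e1 := blk_eq_of_hull_block (y + unitVec μ) hr hb 0 h1
    have e2 := blk_eq_of_hull_block (y + unitVec μ) hr hb 0 h2
    rw [sub_zero] at e1 e2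
    refine ⟨κ', x', Or.inr e1, Or.inr e2, ?_⟩
    rcases h3 with h3 | h3
    · right; rw [h3]
    · left; rw [h3, neg_neg]

/-- NOT IN PRINT; OUR BOOKKEEPING.  **THE TWO-BLOCK SUPPORT OF `q¹,ρ` (integer count)**: if NOT both endpoints of the bond `f` have block label in `{y, y+e_μ}`, the rooted
count vanishes — no rooted contour of the coarse bond `(μ,y)` passes through `f`. -/
theorem linCountAt_eq_zero_of_not_twoBlock {L : ℕ} (hL : 1 ≤ L) {μ : Fin (d + 1)} {y : Site (d + 1)} {r : Fin (d + 1) → ℕ} (hr : r ∈ box (d + 1) L)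
    {f : Bond (d + 1)}
    (h : ¬ ((blk L f.2 = y ∨ blk L f.2 = y + unitVec μ) ∧ (blk L (f.2 + unitVec f.1) = y ∨ blk L (f.2 + unitVec f.1) = y + unitVec μ))) :
    linCountAt (toSite r) L μ y f = 0 := by
  unfold AveragingHessianKernelsRooted.linCountAt AveragingContoursRooted.linAvgAt
  refine Finset.sum_eq_zero fun b hb => List.sum_eq_zero fun a ha => ?_
  obtain ⟨κ', x', h1, h2, h3⟩ := twoBlock_gammaCAt hL (δ1 f) μ y hr hb a ha
  have h0 : δ1 f κ' x' = 0 := by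
    rw [δ1_apply, if_neg]
    rintro rfl
    exact h ⟨h1, h2⟩
  rcases h3 with h3 | h3
  · rw [h3, h0]
  · rw [h3, h0, neg_zero]

/-- [folklore] The same for the real kernel `q¹,ρ = linCountAt ∕ L^{d+1}`. -/
theorem linKerAt_eq_zero_of_not_twoBlock {L : ℕ} (hL : 1 ≤ L) {μ : Fin (d + 1)} {y : Site (d + 1)} {r : Fin (d + 1) → ℕ} (hr : r ∈ box (d + 1) L)
    {f : Bond (d + 1)}
    (h : ¬ ((blk L f.2 = y ∨ blk L f.2 = y + unitVec μ) ∧ (blk L (f.2 + unitVec f.1) = y ∨ blk L (f.2 + unitVec f.1) = y + unitVec μ))) :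
    linKerAt (toSite r) L μ y f = 0 := by
  rw [AveragingHessianKernelsRooted.linKerAt, linCountAt_eq_zero_of_not_twoBlock hL hr h, Int.cast_zero, zero_div]

end Support

/-! ## §2 Block-constant gauge functions: the four-site weight is the jump across the one face between the blocks `y` and `y + e_μ` -/

section BlockConstant

/-- [folklore] With both block labels in `{y, y+e_μ}` the four-site combination `h(blk z) + h(blk z′) − h y − h(y+e_μ)` is `−Δ`, `0` or `+Δ`, `Δ = h(y+e_μ) − h y`. -/
theorem abs_fourSite_le (h : Site (d + 1) → ℝ) {L : ℕ} {μ : Fin (d + 1)} {y z z' : Site (d + 1)}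
    (hz : blk L z = y ∨ blk L z = y + unitVec μ) (hz' : blk L z' = y ∨ blk L z' = y + unitVec μ) :
    |h (blk L z) + h (blk L z') - h y - h (y + unitVec μ)| ≤ |h (y + unitVec μ) - h y| := by
  rcases hz with e | e <;> rcases hz' with e' | e' <;> rw [e, e']
  · rw [show h y + h y - h y - h (y + unitVec μ) = -(h (y + unitVec μ) - h y) by ring, abs_neg]
  · rw [show h y + h (y + unitVec μ) - h y - h (y + unitVec μ) = 0 by ring, abs_zero]; exact abs_nonneg _
  · rw [show h (y + unitVec μ) + h y - h y - h (y + unitVec μ) = 0 by ring, abs_zero]; exact abs_nonneg _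
  · rw [show h (y + unitVec μ) + h (y + unitVec μ) - h y - h (y + unitVec μ) = h (y + unitVec μ) - h y by ring]

/-- [folklore] The root and the far root have block labels `y` and `y + e_μ`. -/
theorem blk_root {L : ℕ} (y : Site (d + 1)) {r : Fin (d + 1) → ℕ} (hr : r ∈ box (d + 1) L) : blk L ((L : ℤ) • y + toSite r) = y :=
  blk_block y hr

/-- [folklore] The far root has block label `y + e_μ`. -/
theorem blk_farRoot {L : ℕ} (y : Site (d + 1)) (μ : Fin (d + 1)) {r : Fin (d + 1) → ℕ} (hr : r ∈ box (d + 1) L) :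
    blk L ((L : ℤ) • y + toSite r + (L : ℤ) • unitVec μ) = y + unitVec μ := by
  rw [show (L : ℤ) • y + toSite r + (L : ℤ) • unitVec μ = (L : ℤ) • (y + unitVec μ) + toSite r by rw [smul_add]; abel]
  exact blk_block _ hr

/-- NOT IN PRINT; OUR BOOKKEEPING.  **FOR A BLOCK-CONSTANT GAUGE FUNCTION THE FOUR-SITE WEIGHT OF THE Λ CONTACT KERNEL IS A FACE JUMP** (box root, EVERY bond `(b,z)`):
`ψ = h ∘ blk L` ⇒ `|(ψ z + ψ(z+e_b) − ψ(L·y+ρ) − ψ(L·y+ρ+L·e_μ))·q¹,ρ_{(μ,y)}(b,z)| ≤ |h(y+e_μ) − h y|·|q¹,ρ_{(μ,y)}(b,z)|` — off the two-block support both sides vanish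
(§1), on it the weight is `∓(h(y+e_μ) − h y)` or `0` (`abs_fourSite_le`). -/
theorem abs_weight_mul_linKerAt_le {L : ℕ} (hL : 1 ≤ L) {r : Fin (d + 1) → ℕ} (hr : r ∈ box (d + 1) L) {ψ : Site (d + 1) → ℝ} (h : Site (d + 1) → ℝ)
    (hψ : ∀ u, ψ u = h (blk L u)) (μ : Fin (d + 1)) (y : Site (d + 1)) (b : Fin (d + 1)) (z : Site (d + 1)) :
    |(ψ z + ψ (z + unitVec b) - ψ ((L : ℤ) • y + toSite r) - ψ ((L : ℤ) • y + toSite r + (L : ℤ) • unitVec μ)) * linKerAt (toSite r) L μ y (b, z)|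
      ≤ |h (y + unitVec μ) - h y| * |linKerAt (toSite r) L μ y (b, z)| := by
  simp only [hψ, blk_root y hr, blk_farRoot y μ hr]
  rw [abs_mul]
  by_cases hq : (blk L z = y ∨ blk L z = y + unitVec μ) ∧ (blk L (z + unitVec b) = y ∨ blk L (z + unitVec b) = y + unitVec μ)
  · exact mul_le_mul_of_nonneg_right (abs_fourSite_le h hq.1 hq.2) (abs_nonneg _)
  · rw [linKerAt_eq_zero_of_not_twoBlock (f := (b, z)) hL hr hq, abs_zero, mul_zero, mul_zero]

/-- [folklore] The same against the INTEGER count `linCountAt` (the currency of leaf-02 g48's `ContactLambdaCommutator.linAvgAt_eq_sum_linCountAt`). -/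
theorem abs_weight_mul_linCountAt_le {L : ℕ} (hL : 1 ≤ L) {r : Fin (d + 1) → ℕ} (hr : r ∈ box (d + 1) L) {ψ : Site (d + 1) → ℝ} (h : Site (d + 1) → ℝ)
    (hψ : ∀ u, ψ u = h (blk L u)) (μ : Fin (d + 1)) (y : Site (d + 1)) (b : Fin (d + 1)) (z : Site (d + 1)) :
    |(ψ z + ψ (z + unitVec b) - ψ ((L : ℤ) • y + toSite r) - ψ ((L : ℤ) • y + toSite r + (L : ℤ) • unitVec μ))
        * (linCountAt (toSite r) L μ y (b, z) : ℝ)|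
      ≤ |h (y + unitVec μ) - h y| * |(linCountAt (toSite r) L μ y (b, z) : ℝ)| := by
  simp only [hψ, blk_root y hr, blk_farRoot y μ hr]
  rw [abs_mul]
  by_cases hq : (blk L z = y ∨ blk L z = y + unitVec μ) ∧ (blk L (z + unitVec b) = y ∨ blk L (z + unitVec b) = y + unitVec μ)
  · exact mul_le_mul_of_nonneg_right (abs_fourSite_le h hq.1 hq.2) (abs_nonneg _)
  · rw [linCountAt_eq_zero_of_not_twoBlock (f := (b, z)) hL hr hq, Int.cast_zero, abs_zero, mul_zero, mul_zero]

/-- [folklore] With both block labels in `{y, y+e_μ}` the one-bond difference `h(blk z′) − h(blk z)` is `0` or `±Δ`. -/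
theorem abs_twoSite_le (h : Site (d + 1) → ℝ) {L : ℕ} {μ : Fin (d + 1)} {y z z' : Site (d + 1)}
    (hz : blk L z = y ∨ blk L z = y + unitVec μ) (hz' : blk L z' = y ∨ blk L z' = y + unitVec μ) :
    |h (blk L z') - h (blk L z)| ≤ |h (y + unitVec μ) - h y| := by
  rcases hz with e | e <;> rcases hz' with e' | e' <;> rw [e, e'] <;>
    first
    | (rw [sub_self, abs_zero]; exact abs_nonneg _)
    | exact le_rfl
    | exact (abs_sub_comm (h y) (h (y + unitVec μ))).le

/-- NOT IN PRINT; OUR BOOKKEEPING.  **THE TWO COARSE JUMPS NEVER MULTIPLY** (the row owner's AMENDMENT [GAN24P1-G20-A1] rebuttal (ii), as an EXACT identity): with both block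
labels in `{y, y+e_μ}`, the four-site weight of one block-constant function times the one-bond difference of another VANISHES — on an interior bond the difference is `0`,
on the crossing bond the weight is `0`. -/
theorem fourSite_mul_twoSite_eq_zero (ha hb : Site (d + 1) → ℝ) {L : ℕ} {μ : Fin (d + 1)} {y z z' : Site (d + 1)}
    (hz : blk L z = y ∨ blk L z = y + unitVec μ) (hz' : blk L z' = y ∨ blk L z' = y + unitVec μ) :
    (ha (blk L z) + ha (blk L z') - ha y - ha (y + unitVec μ)) * (hb (blk L z') - hb (blk L z)) = 0 := by
  rcases hz with e | e <;> rcases hz' with e' | e' <;> rw [e, e'] <;> ring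

/-- NOT IN PRINT; OUR BOOKKEEPING.  **THE GRADIENT OF A BLOCK-CONSTANT GAUGE FUNCTION ON THE SUPPORT OF `q¹,ρ` IS AT MOST THE ONE FACE JUMP** (box root, EVERY bond):
`ψ = h ∘ blk L` ⇒ `|(ψ(z+e_b) − ψ z)·linCountAt ρ L μ y (b,z)| ≤ |h(y+e_μ) − h y|·|linCountAt ρ L μ y (b,z)|`. -/
theorem abs_dz_mul_linCountAt_le {L : ℕ} (hL : 1 ≤ L) {r : Fin (d + 1) → ℕ} (hr : r ∈ box (d + 1) L) {ψ : Site (d + 1) → ℝ} (h : Site (d + 1) → ℝ)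
    (hψ : ∀ u, ψ u = h (blk L u)) (μ : Fin (d + 1)) (y : Site (d + 1)) (b : Fin (d + 1)) (z : Site (d + 1)) :
    |(ψ (z + unitVec b) - ψ z) * (linCountAt (toSite r) L μ y (b, z) : ℝ)| ≤ |h (y + unitVec μ) - h y| * |(linCountAt (toSite r) L μ y (b, z) : ℝ)| := by
  simp only [hψ]
  rw [abs_mul]
  by_cases hq : (blk L z = y ∨ blk L z = y + unitVec μ) ∧ (blk L (z + unitVec b) = y ∨ blk L (z + unitVec b) = y + unitVec μ)
  · exact mul_le_mul_of_nonneg_right (abs_twoSite_le h hq.1 hq.2) (abs_nonneg _)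
  · rw [linCountAt_eq_zero_of_not_twoBlock (f := (b, z)) hL hr hq, Int.cast_zero, abs_zero, mul_zero, mul_zero]

/-- NOT IN PRINT; OUR BOOKKEEPING.  **ON THE SUPPORT OF `q¹,ρ` THE FACE JUMPS OF TWO BLOCK-CONSTANT GAUGE FUNCTIONS NEVER MULTIPLY** (box root, EVERY bond `(b,z)`):
`ψ_a = h_a ∘ blk L`, `ψ_b = h_b ∘ blk L` ⇒ `w₄(ψ_a; b,z; μ,y)·(ψ_b(z+e_b) − ψ_b z)·linCountAt ρ L μ y (b,z) = 0` — the ΔΔ cell of the owner's plan v1.1 §0′ has NO `Δ_a·Δ_b` term. -/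
theorem weight_mul_dz_mul_linCountAt_eq_zero {L : ℕ} (hL : 1 ≤ L) {r : Fin (d + 1) → ℕ} (hr : r ∈ box (d + 1) L) {ψa ψb : Site (d + 1) → ℝ}
    (ha hb : Site (d + 1) → ℝ) (hψa : ∀ u, ψa u = ha (blk L u)) (hψb : ∀ u, ψb u = hb (blk L u))
    (μ : Fin (d + 1)) (y : Site (d + 1)) (b : Fin (d + 1)) (z : Site (d + 1)) :
    (ψa z + ψa (z + unitVec b) - ψa ((L : ℤ) • y + toSite r) - ψa ((L : ℤ) • y + toSite r + (L : ℤ) • unitVec μ))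
        * (ψb (z + unitVec b) - ψb z) * (linCountAt (toSite r) L μ y (b, z) : ℝ) = 0 := by
  simp only [hψa, hψb, blk_root y hr, blk_farRoot y μ hr]
  by_cases hq : (blk L z = y ∨ blk L z = y + unitVec μ) ∧ (blk L (z + unitVec b) = y ∨ blk L (z + unitVec b) = y + unitVec μ)
  · rw [fourSite_mul_twoSite_eq_zero ha hb hq.1 hq.2, zero_mul]
  · rw [linCountAt_eq_zero_of_not_twoBlock (f := (b, z)) hL hr hq, Int.cast_zero, mul_zero]

end BlockConstant

end Summit.QuantumFields.BalabanUV.Beta.GAN24.ContactFaceJump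

end
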